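import Literature.NumberTheory.EllipticCurves.Disegni2017.CycLineGrossZagierFact
import HarnessLib

/-!
# The `p = 3` twin of the INTRINSIC clause of `Disegni2017.delbourgoDatum_cycLineGrossZagier`
# (Delbourgo 2002 Thm. (B) read through p. 67 (iv) / p. 69, under the Hypothesis' SECOND bullet) — ONE named fact

Topic `Literature/NumberTheory/EllipticCurves`, cluster `Disegni2017` (namespace = path). ONE named fact
(`def … : Prop`, cited, nothing proved; net literature debt +1), its projection, and one bookkeeping lemma
(proved). Sequel of `CycLineGrossZagierFact.lean`, whose fact `delbourgoDatum_cycLineGrossZagier` asserts,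
for ONE pair of height data `(Dh, DhK)` with `DhK.RestrictsToWith Dh 1`: Delbourgo 2002 Thm. (B) in the
evaluated `ℓ`-currency (`Delbourgo2002.LeadingTermClauses`) at every printed row (`p ≥ 5` (G) ∨ (M) ∨
`p = 3`), Disegni 2017 Thm. A/B on the cyclotomic line (`CycLineGrossZagierClauses`), and — guarded by
`5 ≤ p →` (G) — Thm. (B) in the INTRINSIC `ℓ`-currency (`Delbourgo2002.LeadingTermClausesIntrinsic`: the
factor `[E(ℚ_p) : N_∞E(ℚ_p)]/#𝒯_{/ℤ}(ℤ_p)` of claim (iv) p. 67 and of the p. 69 display, never evaluated —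
the clause bundle of the tree's `Delbourgo2002.mainTheorem_intrinsic`, cell referee ruling (α′)). The
guard `5 ≤ p` there is the FIRST bullet of Delbourgo's Hypothesis; the present fact is the same intrinsic
clause under the SECOND bullet («potentially ordinary at `p = 3` with semistable reduction over a
quadratic extension of `ℚ₃`»), with the hypothesis binders copied VERBATIM from the tree's transcription
of that bullet, `Delbourgo2002.mainTheorem_three` (`Delbourgo2002/PAdicBSDLeadingTerm.lean`: the (G)
cyclotomic-field binder + the good-ordinary quadratic-twist binder; reviewed 2026-08-21 by the n1011
literature seat), and the conclusion shape of the parent's projection `exists_datum_intrinsic` — it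
discharges the marker `-- TODO(p = 3)` of `Delbourgo2002/PAdicBSDLeadingTermIntrinsic.lean`, in the
conjoined (one-datum) form the cell's rank-one end states consume. Filed by the literature seat of the
cell `bsd-addord` (FULL-BSD rank-`≤ 1` programme, row B6 = O7-ord r1 at `p = 3`) on the planner's wake
brief `lit/WAKE-CYCLINE-INTRINSIC-THREE-01d0edfcf484ebf4.md` (request of the prover seat `bsd-addord-gz`,
HOME STATUS 2026-08-26 02:37Z; signature pre-elaborated by the planner, `planner/litwake/SketchCycLineThree.lean`).

## The printed statements and THE READING CONDITION (D. Delbourgo, *On the p-adic Birch, Swinnerton-Dyer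
conjecture for non-semistable reduction*, J. Number Theory 95 (2002) 38–71; held OA text, journal p. = PDF p. + 37;
cell dossier `lit/delbourgo2002/STATEMENTS.md`)

The wake brief's condition: claim (iv) p. 67 and its verification p. 69 must be asserted under the paper's
standing Hypothesis INCLUDING its second bullet — not for `p ≥ 5` only. Read on the held pages (2026-08-26):
* p. 39 (PDF 2 L4–7), **Hypothesis**: «Either • `E` is potentially ordinary at `p ≥ 5`; or • `E` is
  potentially ordinary at `p = 3` with semistable reduction over a quadratic extension of `ℚ₃`.»
* p. 40 (PDF 3 L1), **Theorem**: «Assume that `E` satisfies the Hypothesis. Then (A) … (B) …» ((B) quoted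
  in full in `Delbourgo2002/PAdicBSDLeadingTerm.lean`).
* §2 (local theory): p. 51 (PDF 14 L10) «For the moment assume that `p ≥ 5`» (the list of the possible
  `D_pst(V_pE)`'s); p. 53 (PDF 16 L23) Lemma 2.1 «at `p ≥ 5`»; p. 53 (PDF 16 L42–46), Remark: «If `p = 3`
  then there are two complications; firstly, the analogue of Lemma 2.1 is false, and secondly the tame
  inertia group in [Se] can sometimes be isomorphic to `ℤ/3 ⋊ ℤ/4` which is non-abelian. However, if we
  stick to our Hypothesis then we avoid both these problems.»; then Corollary 2.2 (PDF 16 L47) and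
  Proposition 2.3 (p. 55, PDF 18 L1): «Assume that `E` satisfies the Hypothesis.»
* §3 p. 58 (PDF 21 L13–14): «Proof of Theorem (A), (C). From now on assume that `E` has no complex
  multiplication.»; L31–32: «(so our Hypothesis means that `p ∈ S`)».
* §4 = proof of (B), pp. 60–70 (the paper's `K` here is Delbourgo's semistabilising field, NOT the Heegner
  field `K` of the binders below): p. 61 (PDF 24 L15–18) «We start by making a sensible choice of number
  field `K` such that `E` is semistable at all places of `K` above `p`. Under our Hypothesis we may choose
  `K ⊂ ℚ(μ_{p^∞})` so that if `ord_p j_E ≥ 0` then `[K : ℚ] = e` (resp. if `ord_p j_E < 0` then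
  `[K : ℚ] = 2`); in particular there is only one prime, `𝔭` say, of `K` lying over `p`.» (second bullet:
  `p = 3`, `e = 2`, `K = ℚ(μ₃)`). The places where `[K : ℚ]` is compared with `p`: p. 62 (PDF 25 L7) «Since
  `[K : ℚ]` is prime to `p`, restriction … induces isomorphisms `Sel(E/ℚ) ≅ Sel(E/K)^{⟨τ⟩}` …»; p. 64 (PDF 27
  L27–28) «(as `τ` has prime-to-`p` order)»; p. 65 (PDF 28 L37–40) Remark (the `ℤ_p[τ]`-modules decompose
  into `τ`-eigenspaces); p. 67 (PDF 30 L1–4) «`Reg_p(E/ℚ)` equals `[K : ℚ]^{−r_E} det(⟨,⟩^{Sch}_{p,K}|…)`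
  and this is `p`-adically equivalent to `(log_p κ(γ₀))^{r_E} det(⟨,⟩_{γ₀}|…)` since `[K : ℚ] ∼ 1`» — each
  holds at `p = 3` with `[K : ℚ] = 2`.
* **p. 67 (PDF 30 L15–20, L41–42)**: «`ℓ_p(E) := #Coker(res_∞)#Ker(θ)#H⁰(ℤ, 𝓔⁰_{p^∞})_{/div} /
  (#Ker(res_∞)#Coker(θ)#Ker(i))` (we will see shortly that this `ℓ`-invariant is the same as that of the
  Introduction …) … (iv) The quantity `ℓ_p(E)` has the same `p`-adic order as `[E(ℚ_p) : N_∞E(ℚ_p)]/#𝒯_{/ℤ}(ℤ_p)`.»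
* **p. 69 (PDF 32 L21–45)**: «… so we can finally verify that `ℓ_p(E) ∼ [E(ℚ_p) : N_∞E(ℚ_p)]/#𝒯_{/ℤ}(ℤ_p)`
  as had been claimed in (iv). We have almost finished the proof of Theorem (B). … putting (iii) and (iv)
  together yields `A_{r_E} ∼ ([E(ℚ_p) : N_∞E(ℚ_p)]/#𝒯_{/ℤ}(ℤ_p)) × Reg_p(E/ℚ) #Ш(E/ℚ)_{p^∞} ∏_{primes l}
  #𝒯_{/ℤ}(ℤ_l) / #E_{p^∞}(ℚ)²` … By applying Tate's local Euler characteristic formula we showed in [De]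
  that `N_∞E(ℚ_p)` had finite index in `E(ℚ_p)`» ([De] = Delbourgo 1998, a `p`-odd paper: Compositio 113
  p. 123 «assume `p` denotes an odd rational prime», p. 126 «Let `p` be an odd prime number»).
* THE CUT (as in `mainTheorem_intrinsic`, referee (α′); tree flag `Del02-ThmB-ellp-anomalous`): the
  EVALUATION of the index (p. 69 PDF 32 L46 – p. 70 PDF 33 L10, «`= (#Ĩ(𝔽_p)_{p^∞})² = 1` or `p²`») is
  NOT transcribed. (Its own count «since `p ≥ 3`», PDF 32 L59, and «`e = [K_𝔭 : ℚ_p]` is prime to `p`»,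
  PDF 33 L7, include `p = 3`, but lie downstream of the cut.)
VERDICT of the reading: «`p ≥ 5`» occurs in the paper exactly at p. 39 (first bullet), p. 51 L10 and p. 53
(Lemma 2.1 and its proof) — the local classification of §2, closed off for `p = 3` by the p. 53 Remark —
and NOWHERE in §§3–4 (text search of all 34 held pages); the Theorem, Cor. 2.2, Prop. 2.3 and §§3–4 run
under «the Hypothesis» (both bullets), and claim (iv) / p. 69 are stated for `ord_p j_E ≥ 0` and `< 0`
alike with no restriction on `p` beyond it. READING CONDITION MET: (iv)/p. 69 are in print at `p = 3`
under the second bullet.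

## The fact below (weaker than print; nothing asserted)

Hypotheses = those of `Delbourgo2002.mainTheorem_three` VERBATIM (`W` globally minimal, `p = 3`, no CM
(p. 38 / p. 58), ADDITIVE at `p`, (G) in the cell's global form — a `p`-th cyclotomic field `L`, an
intermediate field `F`, good reduction with unit root at every place of `F` above `p` —, and the DISPLAYED
second-bullet binder: some quadratic twist `W^{(d)}`, `d ≠ 0`, has a globally minimal model `V'` with good
ORDINARY reduction at `p`) ∪ those of the parent fact (`ord_{s=1} L(E,s) = 1`; `C • V^{(p*)} = W`,
`p* = −3`, for a globally minimal `V` good ordinary at `p` with `α = unitRoot V p` or multiplicative with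
`α = a_p(V)` — the latter vacuous under (G), kept for clause-sharing with the parent; `fE` the newform of
`W`; `K` imaginary quadratic, Galois over `ℚ`, Heegner for `N_E = W.conductorNorm ℤ` (so `3` splits in `K`);
`ι : ℚ̄_p ≅ ℂ`). At `p = 3`, `Delbourgo2002PrintedHypotheses W p` holds by its third disjunct
(`delbourgo2002PrintedHypotheses_of_three` below), so the parent fact already gives, for ONE pair
`(Dh, DhK)`, `RestrictsToWith Dh 1 ∧ LeadingTermClauses W p Dh ∧ CycLineGrossZagierClauses W K ι fE α DhK`
at these rows; the present fact asserts that the SAME kind of pair moreover satisfies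
`Delbourgo2002.LeadingTermClausesIntrinsic W p Dh` — Theorem (B) p. 40 with `ℓ_p(E)` replaced by the
p. 67 (iv) / p. 69 quantity (the tree's `localUniversalNormIndex (v.adicCompletion ℚ) κ ⊤` over
`c_p = W.tamagawaNumberAt v`, plus the printed finiteness `0 < ι`), exactly the clause bundle of
`mainTheorem_intrinsic` with `p = 3`. Conclusion shape = the parent's `exists_datum_intrinsic` with
`5 ≤ p ↦ p = 3` (+ the twist binder). Vacuity discipline, REFEREE CONDITION GZ-H and READING r2 exactly
as in the parent's module docstring (one object: Delbourgo's `⟨,⟩_{3,ℚ} = ½⟨,⟩^{Sch}_{3,ℚ(√−3)}`, p. 39 /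
p. 61, = Disegni's pairing restricted to `E(ℚ)`, (4.1.7)–(4.1.8); Disegni 2017 Rem. 1.3.2 with (n-exc)
discharged by `Z_w(𝟙_w) ≠ 0`; Theorem A as corrected in the errata). The Disegni side is UNCHANGED from the
parent (stated there for every odd `p` incl. `3`). KERNEL-side remarks (not part of the fact): at `p = 3`
the twist binder is implied by (G) + additivity (defect `e = 2`, `Summit.….semistabilityIndex_eq_two_of_typeG_three`,
`goodOrd_twist_three_of_typeGOrd`); `c_3 ∈ {1, 2, 4}` (Kodaira `I₀*`) is a `3`-adic unit.

## What is NOT here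

No proof (`_holds`: size L — Delbourgo's flat-cohomological descent §4 + Disegni's theorem + YZZ); no
evaluation of the universal-norm index (the cut); nothing on the (M) rows in the intrinsic currency
(`-- TODO(general form): ord_p j_E < 0, any odd p incl. 3 — print: index 1 there, p. 69; the tree's
`mainTheorem_potMult` has no intrinsic twin`); no defect `3, 4, 6`; nothing at `p = 2`; no choice of `K`
(`waldspurger_exists_heegnerField_twist_ne_zero`, not restated); nothing about the Mazur–Tate–Teitelbaum
branches (consumer's theorem). Nothing is asserted; users take
`(h : delbourgoDatum_cycLineGrossZagier_intrinsicThree)`.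

## References

* [Delbourgo2002] D. Delbourgo, J. Number Theory 95 (2002) 38–71: Hypothesis (p. 39, second bullet),
  `⟨,⟩_{p,ℚ}` / `ℓ_p` (p. 39), Theorem (A), (B) (p. 40), p. 53 (Remark after Lemma 2.1; Cor. 2.2), p. 55
  (Prop. 2.3), p. 58 (no CM), p. 61 (choice of `K`, `N_∞`), p. 62, p. 64, p. 65, p. 67 (`ℓ_p(E)`, (iii), (iv)),
  p. 69 ((iv) verified; `A_{r_E}` display; finiteness), p. 70 (the evaluation NOT transcribed).
* [Delbourgo1998] D. Delbourgo, Compositio Math. 113 (1998) 123–154, §2.2 ([De]: finiteness of the index; `p` odd).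
* [Disegni2017] D. Disegni, Compos. Math. 153 (2017) 1987–2074 = arXiv:1510.02114v3: Thm. A, Thm. B, (1.1.3)–(1.1.4),
  Def. 1.2.2 + fn. (9), Rem. 1.3.2, §4.1 (4.1.7)–(4.1.8) — as in the parent.
* [Disegni2023ShimuraII] D. Disegni, J. Inst. Math. Jussieu 22 (2023), App. B «Errata to [I]» (Thm. A/B, fn. (11)).
* [Disegni2022] D. Disegni, Invent. Math. 230 (2022) 509–649, Cor. 4.5.4. [YuanZhangZhang2013] Thm. 1.2, §7.1.1.
* Tree: `Disegni2017/CycLineGrossZagierFact.lean` (parent fact, `exists_datum_intrinsic`),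
  `Delbourgo2002/PAdicBSDLeadingTerm.lean` (`mainTheorem_three`, binders), `Delbourgo2002/PAdicBSDLeadingTermIntrinsic.lean`
  (`LeadingTermClausesIntrinsic`, `mainTheorem_intrinsic`, the `TODO(p = 3)` marker), `TwistedBranchLeadingTerm.lean`
  (`Delbourgo2002PrintedHypotheses`, third disjunct). Cell: `lit/WAKE-CYCLINE-INTRINSIC-THREE-01d0edfcf484ebf4.md`,
  `planner/litwake/SketchCycLineThree.lean` (sha16 9b055a2840c0f591), `lit/delbourgo2002/STATEMENTS.md`, `REF-tanom.md` (α′).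
-/

noncomputable section

open scoped Classical MatrixGroups ModularForm NumberField

open CongruenceSubgroup WeierstrassCurve NumberField IsDedekindDomain
  Literature.NumberTheory.EllipticCurves Literature.NumberTheory.EllipticCurves.ModularForms
  Literature.NumberTheory.EllipticCurves.Rank1Residual

namespace Literature.NumberTheory.EllipticCurves.Disegni2017

/-! ### §1 Bookkeeping: the `p = 3` hypothesis set gives `Delbourgo2002PrintedHypotheses` (proved) -/

/-- The second-bullet hypothesis set at `p = 3` ((G) in the cell's global form + a good ordinary quadratic
twist, the binders of `Delbourgo2002.mainTheorem_three`) gives `Delbourgo2002PrintedHypotheses W p` by its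
third disjunct (companion of `delbourgo2002PrintedHypotheses_of_typeG` / `_of_potMult`).
[cite: Delbourgo2002, Hypothesis (p. 39, second bullet)] -/
theorem delbourgo2002PrintedHypotheses_of_three {W : WeierstrassCurve ℚ} [W.IsElliptic] {p : ℕ}
    [Fact p.Prime] (hp3 : p = 3)
    (hG : ∃ (L : Type) (_ : Field L) (_ : NumberField L) (_ : IsCyclotomicExtension {p} ℚ L)
        (F : IntermediateField ℚ L),
        ∀ w : HeightOneSpectrum (𝓞 F), (p : 𝓞 F) ∈ w.asIdeal →
          (W.baseChange F).HasGoodReductionAt w ∧ (W.baseChange F).HasUnitRootAt w)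
    (hT : ∃ (d : ℚ) (V' : WeierstrassCurve ℚ) (_ : V'.IsElliptic) (_ : V'.IsGloballyMinimal)
        (C' : VariableChange ℚ), d ≠ 0 ∧ C' • W.quadraticTwist d = V' ∧
        V'.HasGoodReductionAtPrime p ∧ ¬ (p : ℤ) ∣ V'.frobeniusTrace p) :
    Delbourgo2002PrintedHypotheses W p :=
  Or.inr (Or.inr ⟨hp3, hG, hT⟩)

/-! ### §2 The named fact -/

/-- **Delbourgo's datum is the restriction of Disegni's, and at `p = 3` (Hypothesis, SECOND bullet) the
printed theorems hold for it in BOTH `ℓ`-currencies**: for `W/ℚ` globally minimal WITHOUT CM, `p = 3`,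
ADDITIVE at `p`, (G)-ordinary in the printed global form (a `p`-th cyclotomic field `L`, an intermediate
field `F`, good reduction with unit root at every place of `F` above `p`) and — the displayed second-bullet
clause «potentially ordinary at `p = 3` with semistable reduction over a quadratic extension of `ℚ₃`» as
transcribed by `Delbourgo2002.mainTheorem_three` — some quadratic twist `W^{(d)}`, `d ≠ 0`, with a globally
minimal model `V'` good ORDINARY at `p`; `ord_{s=1} L(E,s) = 1`; `C • V^{(p*)} = W` (`p* = −3`) for a
globally minimal `V` good ordinary at `p` (`α = unitRoot V p`) or multiplicative (`α = a_p(V)`; vacuous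
under (G)); `fE` the newform of `W`; `K` imaginary quadratic, Galois over `ℚ`, with every prime dividing
`N_E = W.conductorNorm ℤ` split in `K`; `ι : ℚ̄_p ≅ ℂ`: there are a `ℚ`-datum `Dh` (print: Delbourgo's
`⟨,⟩_{3,ℚ} = ½⟨,⟩^{Sch}_{3,ℚ(√−3)}`, p. 39 / p. 61) and a `K`-datum `DhK` (Disegni's pairing at `𝟙_K`,
(4.1.7)–(4.1.8)) with `DhK.RestrictsToWith Dh 1`, `Delbourgo2002.LeadingTermClausesIntrinsic W p Dh`
(Thm. (B) p. 40 with `ℓ_p(E)` read through claim (iv) p. 67 / p. 69 as `[E(ℚ_p) : N_∞E(ℚ_p)]/c_p`, the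
index never evaluated — cut upstream of p. 70, referee (α′), flag `Del02-ThmB-ellp-anomalous`),
`Delbourgo2002.LeadingTermClauses W p Dh` (Thm. (B), evaluated currency, `ℓ ∣ 9`, `= 1` off the anomalous
rows) and `CycLineGrossZagierClauses W K ι fE α DhK` (Disegni 2017 Thm. A on the line ∧ Thm. B ÷ YZZ (1.1.3)
at `𝟙_K`, as corrected in the errata; unchanged from the parent fact). READING CONDITION (module docstring):
the Theorem (p. 40), Cor. 2.2 / Prop. 2.3 (p. 53 / p. 55) and the whole of §§3–4 incl. (iv) p. 67 and its
verification p. 69 are printed under «the Hypothesis», whose second bullet is `p = 3` (p. 39; p. 53 Remark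
«if we stick to our Hypothesis then we avoid both these problems»; p. 61 «Under our Hypothesis we may
choose `K ⊂ ℚ(μ_{p^∞})` … `[K : ℚ] = e`»); «`p ≥ 5`» occurs only in §2's local list (p. 51) and Lemma 2.1
(p. 53). The `p = 3` twin of the intrinsic clause of `delbourgoDatum_cycLineGrossZagier` (there guarded by
`5 ≤ p`, first bullet); binders = `Delbourgo2002.mainTheorem_three` ∪ the parent's; vacuity discipline,
REFEREE CONDITION GZ-H and READING r2 verbatim as in the parent. Weaker than print (the twist binder is
displayed although implied; (C), (D), the p. 70 evaluation, the (M) rows not transcribed). Nothing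
asserted; users take `(h : delbourgoDatum_cycLineGrossZagier_intrinsicThree)`; no `_holds` (size L).
[cite: Delbourgo2002, Theorem (B) (p. 40) with p. 67 (iv) and p. 69 (A_{r_E} display, finiteness), under the Hypothesis p. 39 SECOND bullet (p = 3); p. 53 (Remark, Cor. 2.2), p. 55 (Prop. 2.3), p. 58 (no CM), p. 61 ([K:ℚ] = e, N_∞), p. 67 L1–4 ([K:ℚ] ∼ 1)]
[cite: Disegni2017, Thm. A (§1.2, arXiv v3 PDF 7–8), Thm. B (§1.3.2, PDF 9), (1.1.3)–(1.1.4), Def. 1.2.2 + fn. (9), Rem. 1.3.2, §4.1 (4.1.7)–(4.1.8)]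
[cite: Disegni2023ShimuraII, App. B Thm. A/B and fn. (11)] [cite: YuanZhangZhang2013, Thm. 1.2, §7.1.1] -/
def delbourgoDatum_cycLineGrossZagier_intrinsicThree : Prop :=
  ∀ (W : WeierstrassCurve ℚ) [W.IsElliptic] [W.IsGloballyMinimal] (p : ℕ) [Fact p.Prime]
    (K : Type) [Field K] [NumberField K] [IsGalois ℚ K] (ι : PadicAlgCl p ≃+* ℂ)
    (V : WeierstrassCurve ℚ) [V.IsElliptic] [V.IsGloballyMinimal] (C : VariableChange ℚ)
    {N : ℕ} [NeZero N] (fE : CuspForm (Gamma0 N) 2) (α : ℚ_[p]),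
    p = 3 → ¬ W.HasCM →
    (¬ W.HasGoodReductionAtPrime p ∧ ¬ W.HasMultiplicativeReductionAtPrime p) →
    (∃ (L : Type) (_ : Field L) (_ : NumberField L) (_ : IsCyclotomicExtension {p} ℚ L)
        (F : IntermediateField ℚ L),
        ∀ w : HeightOneSpectrum (𝓞 F), (p : 𝓞 F) ∈ w.asIdeal →
          (W.baseChange F).HasGoodReductionAt w ∧ (W.baseChange F).HasUnitRootAt w) →
    (∃ (d : ℚ) (V' : WeierstrassCurve ℚ) (_ : V'.IsElliptic) (_ : V'.IsGloballyMinimal)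
        (C' : VariableChange ℚ), d ≠ 0 ∧ C' • W.quadraticTwist d = V' ∧
        V'.HasGoodReductionAtPrime p ∧ ¬ (p : ℤ) ∣ V'.frobeniusTrace p) →
    W.analyticRank = 1 →
    C • V.quadraticTwist (pStar p : ℚ) = W →
    ((Good V p ∧ IsOrdinaryAt V p ∧ α = (unitRoot V p : ℚ_[p])) ∨
      (Mult V p ∧ α = ((V.LFunction p : ℤ) : ℚ_[p]))) →
    IsNewformOf W fE →
    IsImaginaryQuadratic K → SatisfiesHeegnerHypothesis (W.conductorNorm ℤ) K →
    ∃ (Dh : PAdicHeightData W p) (DhK : PAdicHeightDataK W p K),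
      DhK.RestrictsToWith Dh 1 ∧
      Delbourgo2002.LeadingTermClausesIntrinsic W p Dh ∧
      Delbourgo2002.LeadingTermClauses W p Dh ∧
      CycLineGrossZagierClauses W K ι fE α DhK

/-! ### §3 Projection (the shape the cell's `p = 3` end state consumes) -/

namespace delbourgoDatum_cycLineGrossZagier_intrinsicThree

/-- **The (B♮)-currency shape at `p = 3`** — the parent's `exists_datum_intrinsic` with `5 ≤ p ↦ p = 3`
plus the second-bullet twist binder: `∃ Dh DhK, DhK.RestrictsToWith Dh 1 ∧
Delbourgo2002.LeadingTermClausesIntrinsic W p Dh ∧ Delbourgo2002.LeadingTermClauses W p Dh ∧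
CycLineGrossZagierClauses W K ι fE α DhK` — ONE datum for both readings of Thm. (B).
[cite: Delbourgo2002, Theorem (B) (p. 40), p. 67 (iv), p. 69, Hypothesis p. 39 second bullet]
[cite: Disegni2017, Thm. A/B (arXiv v3 PDF 7–9)] -/
theorem exists_datum_intrinsic_three (h : delbourgoDatum_cycLineGrossZagier_intrinsicThree)
    {W : WeierstrassCurve ℚ} [W.IsElliptic] [W.IsGloballyMinimal] {p : ℕ} [Fact p.Prime]
    {K : Type} [Field K] [NumberField K] [IsGalois ℚ K] (ι : PadicAlgCl p ≃+* ℂ)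
    {V : WeierstrassCurve ℚ} [V.IsElliptic] [V.IsGloballyMinimal] {C : VariableChange ℚ}
    {N : ℕ} [NeZero N] {fE : CuspForm (Gamma0 N) 2} {α : ℚ_[p]}
    (hp3 : p = 3) (hcm : ¬ W.HasCM)
    (hadd : ¬ W.HasGoodReductionAtPrime p ∧ ¬ W.HasMultiplicativeReductionAtPrime p)
    (hG : ∃ (L : Type) (_ : Field L) (_ : NumberField L) (_ : IsCyclotomicExtension {p} ℚ L)
        (F : IntermediateField ℚ L),
        ∀ w : HeightOneSpectrum (𝓞 F), (p : 𝓞 F) ∈ w.asIdeal →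
          (W.baseChange F).HasGoodReductionAt w ∧ (W.baseChange F).HasUnitRootAt w)
    (hT : ∃ (d : ℚ) (V' : WeierstrassCurve ℚ) (_ : V'.IsElliptic) (_ : V'.IsGloballyMinimal)
        (C' : VariableChange ℚ), d ≠ 0 ∧ C' • W.quadraticTwist d = V' ∧
        V'.HasGoodReductionAtPrime p ∧ ¬ (p : ℤ) ∣ V'.frobeniusTrace p)
    (hr : W.analyticRank = 1) (hC : C • V.quadraticTwist (pStar p : ℚ) = W)
    (hα : (Good V p ∧ IsOrdinaryAt V p ∧ α = (unitRoot V p : ℚ_[p])) ∨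
      (Mult V p ∧ α = ((V.LFunction p : ℤ) : ℚ_[p])))
    (hf : IsNewformOf W fE) (hK : IsImaginaryQuadratic K)
    (hHeeg : SatisfiesHeegnerHypothesis (W.conductorNorm ℤ) K) :
    ∃ (Dh : PAdicHeightData W p) (DhK : PAdicHeightDataK W p K),
      DhK.RestrictsToWith Dh 1 ∧ Delbourgo2002.LeadingTermClausesIntrinsic W p Dh ∧
        Delbourgo2002.LeadingTermClauses W p Dh ∧ CycLineGrossZagierClauses W K ι fE α DhK :=
  h W p K ι V C fE α hp3 hcm hadd hG hT hr hC hα hf hK hHeeg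

end delbourgoDatum_cycLineGrossZagier_intrinsicThree

end Literature.NumberTheory.EllipticCurves.Disegni2017

end
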